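import Literature.NumberTheory.EllipticCurves.ModularFormsGamma0Genus
import HarnessLib

/-!
# `dim M₂(Γ₀(N)) = g(X₀(N)) + ν_∞ − 1` for every `N ≥ 1`

Fourth file of the elementary free-module route to the weight-two dimension formulas on `Γ₀(N)`
(`ModularFormsGamma0FreeModule`, `ModularFormsGamma0Rank`, `ModularFormsGamma0Genus`). The third
file proves `dim S₂(Γ₀(N)) = g` (`finrank_cuspForm_two_eq_genusX0_holds`) from the two inequalities
`dim M₂(Γ₀(N)) ≥ g − 1 + ν_∞` (`finrank_gamma0Space_two` + `twelve_mul_genusX0_add_le_card_wt_two`,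
Gannon's weight constraints on a level-one basis) and `dim S₂(Γ₀(N)) + ν_∞ ≥ dim M₂(Γ₀(N)) + 1`
(`finrank_gamma0Space_two_le`, the residue relation `∑_cusps w_c·v_c(f) = 0`), together with Manin's
bound `dim S₂ ≤ g`. Read backwards, the same three facts pin the whole weight-two space:

* `finrank_modularForm_two_add_one` : `dim M₂(Γ₀(N)) + 1 = g(X₀(N)) + ν_∞(N)`;
* `finrank_modularForm_two_eq` : `dim M₂(Γ₀(N)) = g(X₀(N)) + ν_∞(N) − 1` (natural subtraction;
  `ν_∞ ≥ 1`);
* `finrank_modularForm_two_eq_finrank_cuspForm_two_add` : `dim M₂(Γ₀(N)) + 1 = dim S₂(Γ₀(N)) + ν_∞(N)`,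
  i.e. the weight-two Eisenstein quotient `M₂/S₂` has dimension exactly `ν_∞ − 1`.

This is Diamond–Shurman, Thm. 3.5.1 in weight `k = 2` for `Γ = Γ₀(N)` (`dim M₂(Γ) = g − 1 + ε_∞`,
`dim S₂(Γ) = g`), now unconditional in the tree for every level; it is the dimension leaf that makes
"the holomorphic `η`-quotients of level `N` span `M₂(Γ₀(N))`" checkable by a rank count
(Rouse–Webb 2015, Thm. 1 / Cor. 3 setting). No new definitions, no named facts.

## References
* [DiamondShurman2005] F. Diamond, J. Shurman, A First Course in Modular Forms, GTM 228, Thm. 3.5.1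
  (and Thm. 3.1.1 for `g`).
* [Gannon2014] T. Gannon, The theory of vector-valued modular forms for the modular group,
  Contrib. Math. Comput. Sci. 8 (2014), Thm. 3.4 and §3.5.
-/

namespace Literature.NumberTheory.EllipticCurves.ModularForms

open CongruenceSubgroup

variable (N : ℕ) [NeZero N]

/-- **`dim M₂(Γ₀(N)) + 1 = g(X₀(N)) + ν_∞(N)`** for every `N ≥ 1`: the inequalities
`12(g + ν_∞) ≤ 12·#{j : k_j = 2} + 12` (Gannon's constraints on a level-one basis of `M(Γ₀(N))`,
`#{j : k_j = 2} = dim M₂(Γ₀(N))`), `dim M₂ + 1 ≤ dim S₂ + ν_∞` (residue relation) and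
`dim S₂(Γ₀(N)) = g` close up. [cite: DiamondShurman2005, Thm. 3.5.1] [cite: Gannon2014, §3.5] -/
theorem finrank_modularForm_two_add_one :
    Module.finrank ℂ (ModularForm (Gamma0 N) 2) + 1 = genusX0 N + nuInfty N := by
  obtain ⟨wt, F, hb, hwt⟩ := exists_isLevelOneBasis_card_eq N
  have hK := totalWeight_eq hb hwt
  have h8 := twelve_mul_genusX0_add_le_card_wt_two hb hwt hK
  have hq := finrank_gamma0Space_two hb hwt
  have h9 := finrank_gamma0Space_two_le (N := N)
  have hS : Module.finrank ℂ (CuspForm (Gamma0 N) 2) = genusX0 N :=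
    finrank_cuspForm_two_eq_genusX0_holds N
  have hM : Module.finrank ℂ (gamma0Space N 2) = Module.finrank ℂ (ModularForm (Gamma0 N) 2) :=
    finrank_formSpace _ 2
  omega

/-- **The weight-two dimension formula `dim M₂(Γ₀(N)) = g(X₀(N)) + ν_∞(N) − 1`** (`N ≥ 1`;
`ν_∞ ≥ 1`, so the natural-number subtraction is exact — see `finrank_modularForm_two_add_one`).
[cite: DiamondShurman2005, Thm. 3.5.1] -/
theorem finrank_modularForm_two_eq :
    Module.finrank ℂ (ModularForm (Gamma0 N) 2) = genusX0 N + nuInfty N - 1 := by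
  have h := finrank_modularForm_two_add_one N
  omega

/-- **`dim M₂(Γ₀(N)) + 1 = dim S₂(Γ₀(N)) + ν_∞(N)`**: the weight-two Eisenstein space of `Γ₀(N)`
has dimension exactly `ν_∞ − 1` (the residue relation is the only obstruction).
[cite: DiamondShurman2005, Thm. 3.5.1] -/
theorem finrank_modularForm_two_eq_finrank_cuspForm_two_add :
    Module.finrank ℂ (ModularForm (Gamma0 N) 2) + 1 =
      Module.finrank ℂ (CuspForm (Gamma0 N) 2) + nuInfty N := by
  have h := finrank_modularForm_two_add_one N
  have hS : Module.finrank ℂ (CuspForm (Gamma0 N) 2) = genusX0 N :=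
    finrank_cuspForm_two_eq_genusX0_holds N
  omega

end Literature.NumberTheory.EllipticCurves.ModularForms
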